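import Mathlib
import Summits.ResolutionOfSingularities.ResolutionOfSingularities.Theorems.HomologicalConductorNoZenoCaInvertibleMinRes
import Summits.ResolutionOfSingularities.ResolutionOfSingularities.Theorems.HomologicalConductorNoZenoMinResolutionExists
import Summits.ResolutionOfSingularities.ResolutionOfSingularities.Theorems.HomologicalConductorNoZenoSkyPointLifts
import Summits.ResolutionOfSingularities.ResolutionOfSingularities.Theorems.HomologicalConductorNoZenoSkyBridge
import Summits.ResolutionOfSingularities.ResolutionOfSingularities.Theorems.HomologicalConductorNoZenoCaPrincipalSky
import Summits.ResolutionOfSingularities.ResolutionOfSingularities.Theorems.HomologicalConductorNoZenoCaPrincipalReductions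
import Summits.ResolutionOfSingularities.ResolutionOfSingularities.Theorems.HomologicalConductorNoZenoBasePtsFinite
import Summits.ResolutionOfSingularities.ResolutionOfSingularities.Theorems.HomologicalConductorNoZenoRegularOfBasePtsEmpty
import Summits.ResolutionOfSingularities.ResolutionOfSingularities.Theorems.HomologicalConductorNoZenoBasePtsStrictAnti
import Summits.ResolutionOfSingularities.ResolutionOfSingularities.Theorems.HomologicalConductorPersistenceRadical
import Summits.ResolutionOfSingularities.ResolutionOfSingularities.Theorems.HomologicalConductorPersistenceSurfaceTowerDim
import HarnessLib

/-!
# Crux `NoZenoR` / `NoZeno` (stmt-ResolutionOfSingularities-19943 / -16483), line `sandwich-cluster`: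
# THE SURFACE CORE BY NAME — the canonical `ca`-tower resolves every SANDWICHED surface germ along EVERY
# valuation (modulo six printed facts); corollary for the kill test `SurfaceTermination` (stmt-16488)

`[OURS · L W4.4]` Route `ResolutionOfSingularities/HomologicalConductor`, crux chain W4.4 (cell res-hironaka).
Nothing here is a statement of the manuscript under review (Hironaka 2017); AI-written, weaker than expert
review.

The registered skeleton of the crux (lead res-L0-w44-lead-1, v21 dfebf5c3d18c1adc → v22) composes its
dimension-two branch from registered stubs that are now ALL theorems of the tree — GE `stub_minResolutionExists`
(p502369), **G4′ `stub_caInvertibleMinRes` = THEOREM A** (p513073), P1.3′ `stub_skyPointLifts` (p504303), and the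
cluster calculus S1 `stub_basePtsFinite` (p484230), S2 `stub_regularOfBasePtsEmpty` (p488203), S4
`stub_basePtsStrictAnti` (p485337) — by glue that is kernel-checked INSIDE the skeleton file only
(`skyPrincipal_of_G`, `caPrincipalUpstairsCore_of_skyPrincipal`, `caPrincipalUpstairs_of_core`,
`sandwichedTerminationCore_of_cluster`).  The skeleton keeps open stubs in transcendence degree `≥ 3` and
cannot land; this file makes the dimension-two result a THEOREM OF THE TREE, by name, with the same glue:

* `caPrincipalUpstairs_of_facts` — **(Q_val) at every late sandwiched stage**: for `m ≥ m₀ + 1` and every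
  regular local `S ⊇ T_m`, the ideal `ca(T_m)·S` is principal (GE + G4′ + P1.3′ over the bridge
  `isPrincipal_map_inclusion_of_lift`, p499137; sky points suffice, p489646; Layer 0, p488997).
* `sandwichedTermination_of_facts` — **for every sandwich context `SandwichCtx O A R m₀` the tower reaches a
  regular stage**: strong induction on the number of base points `Set.ncard (basePts R T_m)` (S1 finite, S2
  empty ⇒ regular, S4 strict descent while the next stage is singular).  No hypothesis on the valuation ring
  `O` beyond the datum (any rank, any value group), no `Persistence`, no `StrictDrop`.
* `surfaceTermination_of_sandwiched` — **the kill test `SurfaceTermination` (stmt-16488) for SANDWICHED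
  starting germs**: if `dim A = 2` and the first stage `T₀ = loc O A` contains a regular local `k`-subalgebra
  `R ⊆ O` of `K` with `Frac R = K` and `loc O R = R` (the germ of `Spec A` at the centre of `O` is sandwiched —
  Spivakovsky's class — e.g. every germ birational over a regular surface germ at the centre), then some stage
  `T_m` is a regular local ring; `surfaceTermination_of_le_tower` is the same with the sandwich reached at any
  stage `m₀`.

All three are CONDITIONAL on exactly the registered named-fact bundle of the skeleton
(`stub_publishedSurfaceFacts`): Cossart–Jannsen–Saito 2020 Thm 1.2 (`CossartJannsenSaito2020General`), Lipman 1969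
Prop. (1.2), Thm. (4.1), Thm. (12.1)(i)/(ii), and Görtz–Wedhorn II Cor. 24.44 in Čech form
(`GortzWedhorn2023_24_44_H2`) — all `Literature` named facts; discharging them is the route's fact debt, not
a hypothesis on the datum.  What this does NOT settle of stmt-16488: starting germs that are not sandwiched
(non-rational normal surface points: Theorem A there is open), cf. `…SurfaceTerminationLocalRegimes` (R0/R1/C2c)
and `…SurfaceTerminationResidualCriterion`.

References: M. Spivakovsky, *Sandwiched singularities and desingularization of surfaces by normalized Nash
transformations*, Ann. of Math. 131 (1990) [`Spivakovsky1990`]; J. Lipman, *Rational singularities…*, Publ.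
IHÉS 36 (1969), (1.2), (4.1), (12.1) [`Lipman1969`]; V. Cossart, U. Jannsen, S. Saito, *Desingularization:
invariants and strategy*, LNM 2270 (2020), Thm 1.2 [`CossartJannsenSaito2020`]; U. Görtz, T. Wedhorn,
*Algebraic Geometry II* (2023), Cor. 24.44 [`GortzWedhorn2023`]; S. Iyengar, R. Takahashi, IMRN 2016, Thm 5.4
[`IyengarTakahashi2014`].
-/

-- single-problem summit: the doubled namespace component `ResolutionOfSingularities` is forced
set_option linter.dupNamespace false

noncomputable section

open CategoryTheory AlgebraicGeometry TopologicalSpace IsLocalRing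
open Literature.RingTheory.CohomologyAnnihilator (cohomologyAnnihilator)
open Literature.AlgebraicGeometry.Resolution
open Summit.ResolutionOfSingularities.ResolutionOfSingularities.Theses.HomologicalConductor
open Summit.ResolutionOfSingularities.ResolutionOfSingularities.Theorems.NoZeno.Birth

namespace Summit.ResolutionOfSingularities.ResolutionOfSingularities.Theorems.NoZeno.SandwichCluster

variable {k K : Type} [Field k] [Field K] [Algebra k K]

/-! ## Plumbing -/

/-- The ideal of `S` spanned by `ca T` (the registered stubs' `Ideal.span {s : S | (s : K) ∈ ca T}`) is the
extension of the Literature ideal `cohomologyAnnihilator ↥T` along the inclusion `T ↪ S` (the route's inline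
`ca` is the image of `cohomologyAnnihilator`, `PersistenceRadical.ca_eq_image`).
[cite: IyengarTakahashi2014, Definition 2.1] -/
theorem span_ca_eq_map_inclusion (T S : Subalgebra k K) (hTS : T ≤ S) :
    Ideal.span {s : ↥S | (s : K) ∈ ca T} =
      Ideal.map (Subalgebra.inclusion hTS).toRingHom (cohomologyAnnihilator ↥T) := by
  have hset : {s : ↥S | (s : K) ∈ ca T} =
      (Subalgebra.inclusion hTS) '' (cohomologyAnnihilator ↥T : Set ↥T) := by
    ext s
    rw [Set.mem_setOf_eq, Theorems.HomologicalConductor.PersistenceRadical.ca_eq_image]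
    constructor
    · rintro ⟨t, ht, hts⟩
      exact ⟨t, ht, Subtype.ext (by simpa using hts)⟩
    · rintro ⟨t, ht, rfl⟩
      exact ⟨t, ht, rfl⟩
  rw [hset, Ideal.map]
  rfl

/-! ## (Q_val) at the late sandwiched stages, from GE + G4′ + P1.3′ -/

/-- **THEOREM A at sky points** (the skeleton's `skyPrincipal_of_G`, now over tree theorems): for a singular
sandwiched stage `T_m` (`m ≥ m₀ + 1`) and a sky point `S` of `T_m` — a two-dimensional regular local `S ⊇ T_m`
dominating `T_m` and `R`, a quadratic transform of an infinitely near point `Q ⊉ T_m` of `R` — the ideal `ca(T_m)·S`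
is principal: GE (`stub_minResolutionExists`, p502369) gives a minimal resolution `X`, P1.3′ (`stub_skyPointLifts`,
p504303) lifts `Spec S ⟶ Spec T_m` through it, the structure map at the lifted point is local because `S` dominates
`T_m`, G4′ (`stub_caInvertibleMinRes`, p513073) makes `ca(T_m)·𝒪_{X,x}` principal there, and the bridge
`isPrincipal_map_inclusion_of_lift` (p499137) transfers principality to `S`.  Modulo the named-fact bundle.
[cite: Lipman1969, Thm. (4.1), (12.1)(ii)] -/
theorem skyPrincipal_of_facts
    (hF : (Literature.AlgebraicGeometry.Resolution.CossartJannsenSaito2020General.{0} ∧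
      Literature.AlgebraicGeometry.Resolution.Lipman1969_1_2.{0} ∧
      Literature.AlgebraicGeometry.Resolution.Lipman1969_4_1.{0} ∧
      Literature.AlgebraicGeometry.Resolution.Lipman1969_12_1_i.{0} ∧
      Literature.AlgebraicGeometry.Resolution.Lipman1969_12_1_ii.{0} ∧
      Literature.AlgebraicGeometry.Morphisms.GortzWedhorn2023_24_44_H2.{0}))
    (p : ℕ) (hp : p.Prime) (k K : Type) [Field k] [CharP k p] [Field K] [Algebra k K]
    (O : ValuationSubring K) (A R : Subalgebra k K) (m₀ : ℕ) (ctx : SandwichCtx O A R m₀)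
    (m : ℕ) (hm : m₀ + 1 ≤ m) (hsing : ¬ IsRegularLocalRing ↥(tower O A m))
    (S : Subalgebra k K) (hTS : tower O A m ≤ S) (hS : IsRegularLocalRing ↥S) (hS2 : ringKrullDim ↥S = 2)
    (hdom : ∀ t : K, t ∈ tower O A m → t⁻¹ ∈ S → t⁻¹ ∈ tower O A m)
    (hdomR : SubringDominates R.toSubring S.toSubring)
    (hsky : ∃ Q : Subring K, Relation.ReflTransGen IsQuadraticTransform R.toSubring Q ∧
      IsQuadraticTransform Q S.toSubring ∧ ¬ (tower O A m).toSubring ≤ Q) :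
    (Ideal.span {s : ↥S | (s : K) ∈ ca (tower O A m)}).IsPrincipal := by
  obtain ⟨hCJS, h12, h41, h121i, h121ii, hGW⟩ := hF
  obtain ⟨X, π, hπ⟩ := stub_minResolutionExists hCJS h12 h41 p hp k K O A R m₀ ctx m hm hsing
  obtain ⟨l, hl⟩ := stub_skyPointLifts hCJS p hp k K O A R m₀ ctx m hm hsing S hTS hS hS2 hdom hdomR hsky X π hπ
  haveI : IsLocalRing ↥S := inferInstance
  rw [span_ca_eq_map_inclusion (tower O A m) S hTS]
  refine isPrincipal_map_inclusion_of_lift (tower O A m) S hTS π l hl ?_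
  refine stub_caInvertibleMinRes ⟨hCJS, h12, h41, h121i, h121ii, hGW⟩ p hp k K O A R m₀ ctx m hm hsing X π hπ _ ?_
  -- the structure map at the lifted point is local: composed with `stalkClosedPointTo l` it is the local inclusion
  haveI hloc := isLocalHom_inclusion_of_dominates hTS hdom
  refine ⟨fun t ht => ?_⟩
  have hcomp := stalkClosedPointTo_germ_appTop π (Subalgebra.inclusion hTS).toRingHom l hl t
  have hu : IsUnit ((Subalgebra.inclusion hTS).toRingHom t) := by
    rw [← hcomp]
    exact ht.map _
  exact hloc.map_nonunit t hu

/-- **(Q_val) at every late sandwiched stage** (the skeleton's v10 text `stub_caPrincipalUpstairs` — the former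
OPEN CORE of the surface case — now a theorem modulo the named facts): for `m ≥ m₀ + 1` and EVERY regular local
`S ⊇ T_m`, the ideal `ca(T_m)·S` is principal.  A regular stage has `ca·S = S` (Layer 0, p488997:
`span_ca_eq_top_of_isRegularLocalRing`, Sing = V(ca)); at a singular stage sky points suffice
(`caPrincipalUpstairs_of_skyPoints`, p489646: Abhyankar's factorisation of the regular `S ⊇ R` and the
non-dominated reductions), the branch `S = R` being contradictory for a singular stage containing `R`, and at sky
points `skyPrincipal_of_facts` applies. [cite: IyengarTakahashi2014, Thm. 5.4] [cite: Abhyankar1956Valuations, Thm. 3]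
[cite: Lipman1969, (12.1)(ii)] -/
theorem caPrincipalUpstairs_of_facts
    (hF : (Literature.AlgebraicGeometry.Resolution.CossartJannsenSaito2020General.{0} ∧
      Literature.AlgebraicGeometry.Resolution.Lipman1969_1_2.{0} ∧
      Literature.AlgebraicGeometry.Resolution.Lipman1969_4_1.{0} ∧
      Literature.AlgebraicGeometry.Resolution.Lipman1969_12_1_i.{0} ∧
      Literature.AlgebraicGeometry.Resolution.Lipman1969_12_1_ii.{0} ∧
      Literature.AlgebraicGeometry.Morphisms.GortzWedhorn2023_24_44_H2.{0}))
    (p : ℕ) (hp : p.Prime) (k K : Type) [Field k] [CharP k p] [Field K] [Algebra k K]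
    (O : ValuationSubring K) (A R : Subalgebra k K) (m₀ : ℕ) (ctx : SandwichCtx O A R m₀)
    (m : ℕ) (hm : m₀ + 1 ≤ m) (S : Subalgebra k K) (hTS : tower O A m ≤ S) (hS : IsRegularLocalRing ↥S) :
    (Ideal.span {s : ↥S | (s : K) ∈ ca (tower O A m)}).IsPrincipal := by
  obtain ⟨hk, hA, hfr, hAO, -, hR, -, -, -, hRT⟩ := id ctx
  haveI := hS
  by_cases hreg : IsRegularLocalRing ↥(tower O A m)
  · rw [span_ca_eq_top_of_isRegularLocalRing O A hk hA hfr hAO m hreg S hTS]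
    exact ⟨⟨1, by simp⟩⟩
  refine caPrincipalUpstairs_of_skyPoints p hp k K O A R m₀ ctx m hm ?_ S hTS hS
  intro S' hTS' hS' hS2' hdom' hdomR' hsky'
  rcases hsky' with hR' | hQ
  · -- `S' = R`: then `R ≤ T_m ≤ S' = R` makes the singular stage the regular ring `R`
    exfalso
    have hTR : tower O A m ≤ R := hR' ▸ hTS'
    exact hreg (le_antisymm hTR (hRT m (by omega)) ▸ hR)
  · exact skyPrincipal_of_facts hF p hp k K O A R m₀ ctx m hm hreg S' hTS' hS' hS2' hdom' hdomR' hQ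

/-! ## Termination of every sandwiched tail -/

/-- **THE SURFACE CORE BY NAME: the canonical normalised `ca`-tower resolves every sandwiched surface germ along
every valuation** (the skeleton's `sandwichedTerminationCore_of_cluster` over tree theorems).  For every sandwich
context `SandwichCtx O A R m₀` — `k ⊆ O` ANY valuation ring of `K`, `A ⊆ O` finitely generated with `Frac A = K`,
`tr.deg_k K = 2`, `R ⊆ O` regular local with `Frac R = K`, `loc O R = R`, and `R ≤ T_m` for `m ≥ m₀` — some stage
`T_m` is a regular local ring.  Proof: strong induction on `N = Set.ncard (basePts R T_m)` from `m = m₀ + 1`: no base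
point ⇒ regular (S2, p488203); otherwise the next stage is regular, or it has strictly fewer base points (S4,
p485337, fed with (Q_val) = `caPrincipalUpstairs_of_facts`), finitely many (S1, p484230).  No `Persistence`, no
`StrictDrop`, no restriction on `O`; modulo the named-fact bundle only.
[cite: Spivakovsky1990, §II] [cite: Lipman1969, (12.1)(ii)] -/
theorem sandwichedTermination_of_facts
    (hF : (Literature.AlgebraicGeometry.Resolution.CossartJannsenSaito2020General.{0} ∧
      Literature.AlgebraicGeometry.Resolution.Lipman1969_1_2.{0} ∧
      Literature.AlgebraicGeometry.Resolution.Lipman1969_4_1.{0} ∧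
      Literature.AlgebraicGeometry.Resolution.Lipman1969_12_1_i.{0} ∧
      Literature.AlgebraicGeometry.Resolution.Lipman1969_12_1_ii.{0} ∧
      Literature.AlgebraicGeometry.Morphisms.GortzWedhorn2023_24_44_H2.{0}))
    (p : ℕ) (hp : p.Prime) (k K : Type) [Field k] [CharP k p] [Field K] [Algebra k K]
    (O : ValuationSubring K) (A R : Subalgebra k K) (m₀ : ℕ) (ctx : SandwichCtx O A R m₀) :
    ∃ m : ℕ, IsRegularLocalRing ↥(tower O A m) := by
  suffices key : ∀ n : ℕ, ∀ m : ℕ, m₀ + 1 ≤ m → (basePts R (tower O A m)).ncard = n →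
      ∃ m' : ℕ, IsRegularLocalRing ↥(tower O A m') from key _ (m₀ + 1) le_rfl rfl
  intro n
  induction n using Nat.strong_induction_on with
  | _ n ih =>
    intro m hm hn
    rcases (basePts R (tower O A m)).eq_empty_or_nonempty with hempty | hne
    · exact ⟨m, stub_regularOfBasePtsEmpty p hp k K O A R m₀ ctx m hm hempty⟩
    · by_cases hreg : IsRegularLocalRing ↥(tower O A (m + 1))
      · exact ⟨m + 1, hreg⟩
      · have hfin : (basePts R (tower O A m)).Finite := stub_basePtsFinite p hp k K O A R m₀ ctx m hm
        have hss : basePts R (tower O A (m + 1)) ⊂ basePts R (tower O A m) :=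
          stub_basePtsStrictAnti p hp k K O A R m₀ ctx m hm
            (caPrincipalUpstairs_of_facts hF p hp k K O A R m₀ ctx m hm) hne hreg
        have hlt : (basePts R (tower O A (m + 1))).ncard < n := by
          rw [← hn]; exact Set.ncard_lt_ncard hss hfin
        exact ih _ hlt (m + 1) (by omega) rfl

/-! ## The kill test `SurfaceTermination` (stmt-ResolutionOfSingularities-16488) for sandwiched germs -/

/-- **`SurfaceTermination` once the tower is sandwiched at some stage**: under the binders of the support item
`SurfaceTermination` (`dim A = 2`), if some stage `T_(m₀)` contains a regular local `k`-subalgebra `R ⊆ O` of `K`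
with `Frac R = K` and `loc O R = R`, then some stage is a regular local ring (`tr.deg_k K = dim A = 2` by
`trdeg_eq_of_ringKrullDim_eq`; the tower is increasing, so `R ≤ T_m` for all `m ≥ m₀`).  Modulo the named-fact
bundle; no hypothesis on `O`. [cite: Spivakovsky1990, §II] [cite: Matsumura1987, Thm. 5.6] -/
theorem surfaceTermination_of_le_tower
    (hF : (Literature.AlgebraicGeometry.Resolution.CossartJannsenSaito2020General.{0} ∧
      Literature.AlgebraicGeometry.Resolution.Lipman1969_1_2.{0} ∧
      Literature.AlgebraicGeometry.Resolution.Lipman1969_4_1.{0} ∧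
      Literature.AlgebraicGeometry.Resolution.Lipman1969_12_1_i.{0} ∧
      Literature.AlgebraicGeometry.Resolution.Lipman1969_12_1_ii.{0} ∧
      Literature.AlgebraicGeometry.Morphisms.GortzWedhorn2023_24_44_H2.{0}))
    (p : ℕ) (hp : p.Prime) (k K : Type) [Field k] [CharP k p] [Field K] [Algebra k K]
    (O : ValuationSubring K) (A : Subalgebra k K) (hk : ∀ c : k, algebraMap k K c ∈ O) (hA : A.FG)
    (hfr : IsFractionRing ↥A K) (hAO : A.toSubring ≤ O.toSubring) (hdimA : ringKrullDim ↥A = 2)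
    (R : Subalgebra k K) (hR : IsRegularLocalRing ↥R) (hRfr : IsFractionRing ↥R K)
    (hRO : R.toSubring ≤ O.toSubring) (hlocR : loc O R = R) (m₀ : ℕ) (hRT : R ≤ tower O A m₀) :
    ∃ m : ℕ, IsRegularLocalRing ↥(tower O A m) := by
  haveI := hfr
  have htr : Algebra.trdeg k K = 2 :=
    Theorems.HomologicalConductor.PersistenceSurfaceTowerDim.trdeg_eq_of_ringKrullDim_eq A hA (d := 2)
      (by exact_mod_cast hdimA)
  -- the tower is increasing (`T_m ≤ loc O (nrm (chart T_m)) = T_(m+1)`), so `R ≤ T_m` for all `m ≥ m₀`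
  have hmono : ∀ m : ℕ, m₀ ≤ m → R ≤ tower O A m := by
    intro m hm
    induction hm with
    | refl => exact hRT
    | step _ ih =>
      refine ih.trans fun y hy => ?_
      rw [tower_succ]
      exact Theorems.SyzygyFlattening.self_le_locAt O _
        (Theorems.SyzygyFlattening.self_le_nrm _ (Algebra.subset_adjoin (Or.inl hy)))
  have ctx : SandwichCtx O A R m₀ := ⟨hk, hA, hfr, hAO, htr, hR, hRfr, hRO, hlocR, hmono⟩
  exact sandwichedTermination_of_facts hF p hp k K O A R m₀ ctx

/-- **The kill test `SurfaceTermination` (stmt-ResolutionOfSingularities-16488) HOLDS FOR SANDWICHED STARTING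
GERMS** — the Spivakovsky class, for the `ca`-tower in place of normalised Nash transformations: under the binders
of `SurfaceTermination` (`k ⊆ O` any valuation ring of `K`, `A ⊆ O` finitely generated, `Frac A = K`, `dim A = 2`),
if the first stage `T₀ = loc O A` (the local ring of `Spec A` at the centre of `O`, inside `K`) contains a regular
local `k`-subalgebra `R ⊆ O` with `Frac R = K` and `loc O R = R`, then the canonical normalised `ca`-tower reaches a
regular local ring at some finite stage — along EVERY valuation, unconditionally in `Persistence`/`StrictDrop`,
modulo the six printed facts of the crux's registered bundle.  (For `R` two-dimensional this says: the germ of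
`Spec A` at the centre is a sandwiched singularity over `R` and the tower resolves it; `R` of dimension `≤ 1` is the
degenerate case `T₀ ⊇ R = O`-or-field, where the statement is immediate as well.)
[cite: Spivakovsky1990, §II] [cite: Lipman1969, (12.1)(ii)] -/
theorem surfaceTermination_of_sandwiched
    (hF : (Literature.AlgebraicGeometry.Resolution.CossartJannsenSaito2020General.{0} ∧
      Literature.AlgebraicGeometry.Resolution.Lipman1969_1_2.{0} ∧
      Literature.AlgebraicGeometry.Resolution.Lipman1969_4_1.{0} ∧
      Literature.AlgebraicGeometry.Resolution.Lipman1969_12_1_i.{0} ∧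
      Literature.AlgebraicGeometry.Resolution.Lipman1969_12_1_ii.{0} ∧
      Literature.AlgebraicGeometry.Morphisms.GortzWedhorn2023_24_44_H2.{0}))
    (p : ℕ) (hp : p.Prime) (k K : Type) [Field k] [CharP k p] [Field K] [Algebra k K]
    (O : ValuationSubring K) (A : Subalgebra k K) (hk : ∀ c : k, algebraMap k K c ∈ O) (hA : A.FG)
    (hfr : IsFractionRing ↥A K) (hAO : A.toSubring ≤ O.toSubring) (hdimA : ringKrullDim ↥A = 2)
    (R : Subalgebra k K) (hR : IsRegularLocalRing ↥R) (hRfr : IsFractionRing ↥R K)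
    (hRO : R.toSubring ≤ O.toSubring) (hlocR : loc O R = R) (hRA : R ≤ loc O A) :
    ∃ m : ℕ, IsRegularLocalRing ↥(tower O A m) :=
  surfaceTermination_of_le_tower hF p hp k K O A hk hA hfr hAO hdimA R hR hRfr hRO hlocR 0
    (by rw [tower_zero]; exact hRA)

end Summit.ResolutionOfSingularities.ResolutionOfSingularities.Theorems.NoZeno.SandwichCluster

end
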